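import Mathlib
import Summits.KontsevichZagierPeriods.Zeta5Search.DenomLaw.PathWeightProfile
import Summits.KontsevichZagierPeriods.Zeta5Search.StairRayFLAG
import HarnessLib

/-!
# ζ(5) search — `C⋆` on the θ-cells of the band-60 FLAG ray (profile checks over the 5,040 vertex orderings)

Cell `pub-zeta5` (HONEST FRAMING: systematic search; no irrationality claim unless certified), TRACK «DENOM-LAW» D1 prover seat
(denom-prover-d1 g12, `HOME/denom-law/prover-d1/ATTEMPT-12.md`).  The PATH ACCOUNTING node's combinatorial datum `C⋆_p(b) = cStar b p` on the
band-60 FLAG ray `b(n) = n·(60; 25,24,22,21,19,18,16)`: by the tree's profile tool `cStar_le_of_profile` (`DenomLaw/PathWeightProfile`), a lower bound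
`p > ℓ·n` fixes which parameters (`β_i > ℓ`) and which pair blocks (`60 − β_i − β_k > ℓ`) may reach `p`, and one `decide` over the 5,040 orderings
bounds `C⋆`: `C⋆ ≤ 10` for `p > 17n`, `≤ 9` for `p > 18n`, `≤ 8` for `p > 19n`, `≤ 7` for `p > 20n`, `≤ 6` for `p > 21n`, `≤ 5` for `p > 22n`
(all attained on the next cell: brute force, `n ≤ 12`).  Pure combinatorics; nothing about ζ(5) or irrationality.
-/

open Finset

namespace Summit.KontsevichZagierPeriods.Zeta5Search.StairFLAG

open Summit.KontsevichZagierPeriods.Zeta5Search.DenomLaw (cStar)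
open Summit.KontsevichZagierPeriods.Zeta5Search.DenomLaw.FirstPeriodKit (cStar_le_of_profile)
open Summit.KontsevichZagierPeriods.Zeta5Search.StaircaseCells (bRay)

/-- The ray's lower parameters in closed form: `β_i = 25 − i − ⌊i/2⌋` (`β = (25,24,22,21,19,18,16)`). -/
theorem flag_param (n : ℕ) (i : Fin 7) :
    bRay [60, 25, 24, 22, 21, 19, 18, 16] n (i.val + 1) = ((25 - i.val - i.val / 2 : ℕ) : ℤ) * n := by
  fin_cases i <;> simp [v1, v2, v3, v4, v5, v6, v7] <;> ring

/-- The ray's pair blocks: `60n − β_i n − β_k n`. -/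
theorem flag_block (n : ℕ) (i k : Fin 7) :
    bRay [60, 25, 24, 22, 21, 19, 18, 16] n 0 - bRay [60, 25, 24, 22, 21, 19, 18, 16] n (i.val + 1) - bRay [60, 25, 24, 22, 21, 19, 18, 16] n (k.val + 1)
      = (60 - ((25 - i.val - i.val / 2 : ℕ) : ℤ) - ((25 - k.val - k.val / 2 : ℕ) : ℤ)) * n := by
  rw [flag_param, flag_param, v0]; push_cast; ring

/-- Profile transfer: if `ℓ·n < p` then a parameter reaching `p` has `β_i ≥ ℓ + 1` and a pair block reaching `p` has `β_i + β_k + ℓ + 1 ≤ 60`. -/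
theorem flag_profile {n p ℓ : ℕ} (hp : ℓ * n < p) :
    (∀ i : Fin 7, (p : ℤ) ≤ bRay [60, 25, 24, 22, 21, 19, 18, 16] n (i.val + 1) → ℓ + 1 ≤ (25 - i.val - i.val / 2)) ∧
    (∀ i k : Fin 7, (p : ℤ) ≤ bRay [60, 25, 24, 22, 21, 19, 18, 16] n 0 - bRay [60, 25, 24, 22, 21, 19, 18, 16] n (i.val + 1)
        - bRay [60, 25, 24, 22, 21, 19, 18, 16] n (k.val + 1) →
      (25 - i.val - i.val / 2) + (25 - k.val - k.val / 2) + ℓ + 1 ≤ 60) := by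
  have hpZ : (ℓ : ℤ) * n < p := by exact_mod_cast hp
  have hn : (0 : ℤ) ≤ n := by positivity
  constructor
  · intro i hi
    rw [flag_param] at hi
    set c := ((25 - i.val - i.val / 2)) with hc
    by_contra hlt
    push Not at hlt
    have hcl : (c : ℤ) ≤ ℓ := by exact_mod_cast (by omega : c ≤ ℓ)
    nlinarith
  · intro i k hik
    rw [flag_block] at hik
    set c := ((25 - i.val - i.val / 2)) with hc
    set c' := ((25 - k.val - k.val / 2)) with hc'
    by_contra hlt
    push Not at hlt
    have hi7 : c ≤ 25 := by omega
    have hk7 : c' ≤ 25 := by omega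
    have hcl : (60 : ℤ) - c - c' ≤ ℓ := by
      have : 60 ≤ c + c' + ℓ := by omega
      have : ((60 : ℕ) : ℤ) ≤ ((c + c' + ℓ : ℕ) : ℤ) := by exact_mod_cast this
      push_cast at this; linarith
    nlinarith

/-- **`C⋆ ≤ 10` for `p > 17n`** (longs among `25n,…,18n`; heavy pair blocks `≥ 18n`). -/
theorem cStar_flag_le_ten {n p : ℕ} (hp : 17 * n < p) : cStar (bRay [60, 25, 24, 22, 21, 19, 18, 16] n) p ≤ 10 := by
  obtain ⟨h1, h2⟩ := flag_profile hp
  exact cStar_le_of_profile (fun i : Fin 7 => 17 + 1 ≤ (25 - i.val - i.val / 2))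
    (fun i k : Fin 7 => (25 - i.val - i.val / 2) + (25 - k.val - k.val / 2) + 17 + 1 ≤ 60)
    10 h1 h2 (by decide +kernel)

/-- **`C⋆ ≤ 9` for `p > 18n`.** -/
theorem cStar_flag_le_nine {n p : ℕ} (hp : 18 * n < p) : cStar (bRay [60, 25, 24, 22, 21, 19, 18, 16] n) p ≤ 9 := by
  obtain ⟨h1, h2⟩ := flag_profile hp
  exact cStar_le_of_profile (fun i : Fin 7 => 18 + 1 ≤ (25 - i.val - i.val / 2))
    (fun i k : Fin 7 => (25 - i.val - i.val / 2) + (25 - k.val - k.val / 2) + 18 + 1 ≤ 60)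
    9 h1 h2 (by decide +kernel)

/-- **`C⋆ ≤ 8` for `p > 19n`.** -/
theorem cStar_flag_le_eight {n p : ℕ} (hp : 19 * n < p) : cStar (bRay [60, 25, 24, 22, 21, 19, 18, 16] n) p ≤ 8 := by
  obtain ⟨h1, h2⟩ := flag_profile hp
  exact cStar_le_of_profile (fun i : Fin 7 => 19 + 1 ≤ (25 - i.val - i.val / 2))
    (fun i k : Fin 7 => (25 - i.val - i.val / 2) + (25 - k.val - k.val / 2) + 19 + 1 ≤ 60)
    8 h1 h2 (by decide +kernel)

end Summit.KontsevichZagierPeriods.Zeta5Search.StairFLAG
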